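import Summits.HodgeConjecture.CorCM.MultiFieldWeilFrameTransfer
import Summits.HodgeConjecture.CorCM.SexticOcticWeilHodgeOfMarkman
import HarnessLib

/-!
# MULTI-FIELD WEIL ENGINE — FRAMES FOR A CM FIELD OF ANY DEGREE `2n` THROUGH `k`, and the reading of ANY CM type at the position set it defines

Cell `pub-hodgecm2` (COR-CM), seat b30 gen 29 (2026-08-24); count-neutral own lane MULTI-FIELD WEIL ENGINE (stem `MultiFieldWeil*`).  Theorems only; no definition, no
named fact, no `sorry`.  The size-free form of gen 22ʼs `DecicWeil23Pair.exists_frame₅` / gen 24ʼs `DecicWeil23Multi.exists_frameM` (`n = 5`) and gen 25ʼs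
`OcticWeilMulti.exists_frameO` (`n = 4`): with the generic engine a type may be read at ANY position set, so no normal form (and no case analysis on the type) is needed —
the position set is simply `{a | e⁻¹(a, +) ∈ Φ}`.

* **`exists_signFrame`** — `[K:ℚ] = 2n`, `[k:ℚ] = 2`, `i : k → K`, `Hom(k, ℂ) = {τ, τ̄}`: an enumeration `e : Hom(K, ℂ) ≃ Fin n × Bool` with `(e s).2 = [s ∘ i = τ]` and
  `e s̄ = ((e s).1, ¬(e s).2)` (number the `n` embeddings over `τ`, give `s̄` the number of `s`);
* **`mem_iff_snd_eq_decide_mem_posSet`** — for such a frame and ANY CM type `Φ`: `s ∈ Φ ⟺ (e s).2 = [(e s).1 ∈ P_Φ]`, `P_Φ = {a | e⁻¹(a, +) ∈ Φ}` (over `τ̄` the type is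
  the complement, `Φ` being a CM type), with `card_posSet` (`|P_Φ| = #{s ∈ Φ | s ∘ i = τ}`, the `k`-signature) and the size-free counting lemma `card_filter_symm_true`.
[cite: Shimura1998, §18.2 Lemma (i)] [cite: Deligne1982HodgeCycles, §4 Prop. 4.4]

## References
* [Shimura1998] G. Shimura, *Abelian varieties with CM and modular functions*, §18.2 Lemma (i).  [Deligne1982HodgeCycles] P. Deligne, LNM 900 (1982), §4 Prop. 4.4.
-/

noncomputable section

open NumberField

namespace Summit.HodgeConjecture.CorCM.MultiFieldWeil

open Finset
open Literature.AlgebraicGeometry Literature.AlgebraicGeometry.Motives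
open Summit.HodgeConjecture.CorCM.SexticOcticWeil (card_filter_comp_eq_of_finrank)
open Summit.HodgeConjecture.CorCM.NonGaloisField (conjugate_comp)

open scoped Classical

variable {K : Type} [Field K] [NumberField K] {k : Type} [Field k] [NumberField k]

/-- **THE SIGN FRAME EXISTS in every degree.**  `[K:ℚ] = 2n`, `[k:ℚ] = 2`, `i : k → K`, `Hom(k, ℂ) = {τ, τ̄}`: an enumeration `e : Hom(K, ℂ) ≃ Fin n × Bool` with
`(e s).2 = [s ∘ i = τ]` and `e s̄ = ((e s).1, ¬(e s).2)`. [cite: Shimura1998, §18.2 Lemma (i)] -/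
theorem exists_signFrame {n : ℕ} (hK : Module.finrank ℚ K = 2 * n) (h2 : Module.finrank ℚ k = 2) (i : k →+* K) {τ : k →+* ℂ}
    (hττ : ComplexEmbedding.conjugate τ ≠ τ) (hk : ∀ σ : k →+* ℂ, σ = τ ∨ σ = ComplexEmbedding.conjugate τ) :
    ∃ e : (K →+* ℂ) ≃ Fin n × Bool, (∀ s, (e s).2 = true ↔ s.comp i = τ) ∧
      ∀ s, e (ComplexEmbedding.conjugate s) = ((e s).1, !(e s).2) := by
  -- the `n` embeddings over `τ`
  set F : Finset (K →+* ℂ) := Finset.univ.filter fun s : K →+* ℂ => s.comp i = τ with hFdef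
  have hF : F.card = n := card_filter_comp_eq_of_finrank i hK h2 τ
  let g : {s // s ∈ F} ≃ Fin n := F.equivFinOfCardEq hF
  have hmemF : ∀ s : K →+* ℂ, s ∈ F ↔ s.comp i = τ := fun s => by simp [hFdef]
  -- over `τ̄` the conjugate lies over `τ`
  have hconj_over : ∀ s : K →+* ℂ, ¬ s.comp i = τ → (ComplexEmbedding.conjugate s).comp i = τ := by
    intro s hs
    rw [conjugate_comp, (hk (s.comp i)).resolve_left hs, ComplexEmbedding.involutive_conjugate]
  have hconj_over' : ∀ s : K →+* ℂ, s.comp i = τ → ¬ (ComplexEmbedding.conjugate s).comp i = τ := by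
    intro s hs h
    rw [conjugate_comp, hs] at h
    exact hττ h
  -- the enumeration
  let toF : (K →+* ℂ) → Fin n × Bool := fun s =>
    if h : s.comp i = τ then (g ⟨s, (hmemF s).2 h⟩, true)
    else (g ⟨ComplexEmbedding.conjugate s, (hmemF _).2 (hconj_over s h)⟩, false)
  let ofF : Fin n × Bool → (K →+* ℂ) := fun p =>
    if p.2 then (g.symm p.1).1 else ComplexEmbedding.conjugate (g.symm p.1).1
  have hgF : ∀ a : Fin n, ((g.symm a).1).comp i = τ := fun a => (hmemF _).1 (g.symm a).2
  have hcc : ∀ s : K →+* ℂ, ComplexEmbedding.conjugate (ComplexEmbedding.conjugate s) = s :=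
    ComplexEmbedding.involutive_conjugate K
  have hgcongr : ∀ (s t : K →+* ℂ) (hs : s ∈ F) (ht : t ∈ F), s = t → g ⟨s, hs⟩ = g ⟨t, ht⟩ := by
    rintro s t hs ht rfl; rfl
  have htoF_pos : ∀ s (h : s.comp i = τ), toF s = (g ⟨s, (hmemF s).2 h⟩, true) := fun s h => dif_pos h
  have htoF_neg : ∀ s (h : ¬ s.comp i = τ),
      toF s = (g ⟨ComplexEmbedding.conjugate s, (hmemF _).2 (hconj_over s h)⟩, false) := fun s h => dif_neg h
  have htoF_of : ∀ p, toF (ofF p) = p := by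
    rintro ⟨a, b⟩
    cases b
    · have hof : ofF (a, false) = ComplexEmbedding.conjugate (g.symm a).1 := rfl
      have h : ¬ (ComplexEmbedding.conjugate (g.symm a).1).comp i = τ := hconj_over' _ (hgF a)
      rw [hof, htoF_neg _ h, Prod.mk.injEq]
      refine ⟨?_, rfl⟩
      rw [hgcongr _ _ _ (g.symm a).2 (hcc _), Subtype.coe_eta, Equiv.apply_symm_apply]
    · have hof : ofF (a, true) = (g.symm a).1 := rfl
      rw [hof, htoF_pos _ (hgF a), Prod.mk.injEq]
      exact ⟨by rw [Subtype.coe_eta, Equiv.apply_symm_apply], rfl⟩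
  have hof_toF : ∀ s, ofF (toF s) = s := by
    intro s
    by_cases h : s.comp i = τ
    · rw [htoF_pos s h]
      change (g.symm (g ⟨s, _⟩)).1 = s
      rw [Equiv.symm_apply_apply]
    · rw [htoF_neg s h]
      change ComplexEmbedding.conjugate (g.symm (g ⟨ComplexEmbedding.conjugate s, _⟩)).1 = s
      rw [Equiv.symm_apply_apply]
      exact hcc s
  let e : (K →+* ℂ) ≃ Fin n × Bool := ⟨toF, ofF, hof_toF, htoF_of⟩
  have he : ∀ s, e s = toF s := fun _ => rfl
  refine ⟨e, fun s => ?_, fun s => ?_⟩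
  · rw [he]
    by_cases h : s.comp i = τ
    · rw [htoF_pos s h]; exact ⟨fun _ => h, fun _ => rfl⟩
    · rw [htoF_neg s h]; exact ⟨fun h' => absurd h' Bool.false_ne_true, fun h' => absurd h' h⟩
  · rw [he, he]
    by_cases h : s.comp i = τ
    · have h' : ¬ (ComplexEmbedding.conjugate s).comp i = τ := hconj_over' s h
      rw [htoF_pos s h, htoF_neg _ h', Prod.mk.injEq]
      exact ⟨hgcongr _ _ _ _ (hcc s), rfl⟩
    · have h' : (ComplexEmbedding.conjugate s).comp i = τ := hconj_over s h
      rw [htoF_neg s h, htoF_pos _ h']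
      rfl

omit [NumberField k] in
/-- **Counting through a frame** (size-free): the labels `a` with `P (e⁻¹(a, +))` are as many as the embeddings over `τ` with `P`. [folklore] -/
theorem card_filter_symm_true {n : ℕ} {e : (K →+* ℂ) ≃ Fin n × Bool} {i : k →+* K} {τ : k →+* ℂ}
    (he_sign : ∀ s, (e s).2 = true ↔ s.comp i = τ) (P : (K →+* ℂ) → Prop) :
    (Finset.univ.filter fun a : Fin n => P (e.symm (a, true))).card =
      (Finset.univ.filter fun s : K →+* ℂ => s.comp i = τ ∧ P s).card := by
  refine Finset.card_bij (fun a _ => e.symm (a, true)) (fun a ha => ?_) (fun a _ b _ h => ?_) fun s hs => ?_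
  · exact Finset.mem_filter.2 ⟨Finset.mem_univ _, (he_sign _).1 (by rw [Equiv.apply_symm_apply]),
      (Finset.mem_filter.1 ha).2⟩
  · exact (Prod.mk.inj (e.symm.injective h)).1
  · obtain ⟨-, hsτ, hP⟩ := Finset.mem_filter.1 hs
    have hs' : e.symm ((e s).1, true) = s := by
      rw [show ((e s).1, true) = e s from Prod.ext rfl ((he_sign s).2 hsτ).symm, Equiv.symm_apply_apply]
    exact ⟨(e s).1, Finset.mem_filter.2 ⟨Finset.mem_univ _, by rw [hs']; exact hP⟩, hs'⟩

omit [NumberField K] [NumberField k] in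
/-- **A sign frame reads EVERY CM type at the position set it defines**: `s ∈ Φ ⟺ (e s).2 = [(e s).1 ∈ P_Φ]` with `P_Φ = {a | e⁻¹(a, +) ∈ Φ}` — over `τ` by definition, over `τ̄`
because exactly one of `s, s̄` lies in the CM type `Φ`. [cite: Deligne1982HodgeCycles, §4 Prop. 4.4] -/
theorem mem_iff_snd_eq_decide_mem_posSet {n : ℕ} {e : (K →+* ℂ) ≃ Fin n × Bool}
    (he_conj : ∀ s, e (ComplexEmbedding.conjugate s) = ((e s).1, !(e s).2)) (Φ : CMType K) (s : K →+* ℂ) :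
    s ∈ Φ.1 ↔ (e s).2 = decide ((e s).1 ∈ (Finset.univ.filter fun a : Fin n => e.symm (a, true) ∈ Φ.1)) := by
  have hcc : ComplexEmbedding.conjugate (ComplexEmbedding.conjugate s) = s := ComplexEmbedding.involutive_conjugate K s
  rcases hb : (e s).2 with _ | _
  · -- over `τ̄`: `e s̄ = ((e s).1, true)`, and `s ∈ Φ ⟺ s̄ ∉ Φ`
    have hs' : e.symm ((e s).1, true) = ComplexEmbedding.conjugate s := by
      rw [← Equiv.symm_apply_apply e (ComplexEmbedding.conjugate s), he_conj s, hb]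
      rfl
    rw [Φ.2 s, false_eq_decide_iff, Finset.mem_filter, hs']
    exact ⟨fun h hm => h hm.2, fun h hm => h ⟨Finset.mem_univ _, hm⟩⟩
  · -- over `τ`: `e⁻¹((e s).1, true) = s`
    have hs' : e.symm ((e s).1, true) = s := by
      rw [show ((e s).1, true) = e s from Prod.ext rfl hb.symm, Equiv.symm_apply_apply]
    rw [true_eq_decide_iff, Finset.mem_filter, hs']
    exact ⟨fun h => ⟨Finset.mem_univ _, h⟩, fun h => h.2⟩

omit [NumberField k] in
/-- The size of the position set of `Φ` is its number of members over `τ` (the `k`-signature). [folklore] -/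
theorem card_posSet {n : ℕ} {e : (K →+* ℂ) ≃ Fin n × Bool} {i : k →+* K} {τ : k →+* ℂ}
    (he_sign : ∀ s, (e s).2 = true ↔ s.comp i = τ) (Φ : CMType K) :
    (Finset.univ.filter fun a : Fin n => e.symm (a, true) ∈ Φ.1).card = (Finset.univ.filter fun s : K →+* ℂ => s.comp i = τ ∧ s ∈ Φ.1).card :=
  card_filter_symm_true he_sign fun s => s ∈ Φ.1

end Summit.HodgeConjecture.CorCM.MultiFieldWeil

end
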